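import Summits.CriticalPhenomena.PercolationContinuityZ3.Theorems.Transplant.SkelConcParams
import HarnessLib

/-!
# L7.5b: UNPACKING `AtQ` at the concrete generic choices `SkelConc.Conc.choiceAt` — the side conditions the three
# residue ports (R)/(F)/(C) consume, as named lemmas: the planar / level constants (`r = 4t`, `100 R' ≤ t`, `R' = L + 8M + 13`, `s = 400 (R'+1)`,
# `K₀ ≤ K`), the inputs at the running parameter (`p/2 ≤ q ≤ p` are `hat.2.1` / `hat.2.2.1`) (`hstd_at` / `hlink_at` at every base vertex, any accuracy `a ≥ δmin`), the kit counts at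
# `q ∈ [p/2, p]` (`hk_at`, `hcount_at`), the excess radius (`hRex_at` at every centre), the drifted schedule identities (`hgap_face`, `hgapL`,
# `hsch`, `hRt` with `dG = 100 r` visible), the collar arithmetic (`hL_face`, `hL_reach`, `planar_le_E₀`, `ψ_le_E₀`, …) and the cen bound of
# the inflated cube radius (`cen_le_Erad_at`) — generic twin of `BoxProdZ2ConcParamsAtQ` (p226099)

builds on p205010 (kernel theorem, internal audit signed; external expert review pending) — nothing in this file uses p205010.
Status sentence (coordinator 2026-08-20T04:30Z): "θ(p_c) = 0 on ℤ^d, all d ≥ 2 — kernel-verified (Lean 4/Mathlib, standard axioms); internal adversarial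
audit SIGNED 2026-08-20 04:29Z; external expert review pending."
Lane `prim-bschramm-*`, seat `prim-bschramm-stmt` (gen 7); helper file (`--supports stmt-CriticalPhenomena-4575`).
Parameter ledger: `run/shared/lean/prim/bschramm/prim-bschramm-stmt/CONC-PARAMS-GENERIC.md`.
[cite: KozmaNitzan2024, §4 Theorem 6 (pp. 25–31): the order of constants; Lemma 10 Steps II–III (pp. 18–19); Lemma 12 (p. 24)]
-/

noncomputable section

open MeasureTheory
open scoped Classical

namespace Summit.CriticalPhenomena.PercolationContinuityZ3.Theorems

namespace Transplant

namespace SkelConc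

open Literature.Probability.Percolation Literature.Probability.LatticeModels SimpleGraph KNCells KNLevels
open Literature.Probability.Percolation.GM (HOct)
open Literature.Barriers.CriticalPhenomena (graphBall)
open BoxProdZ2 (ConcRadiiG ConcConsts Erad Frad δmin δmin_pos δmin_sq_pos δmin_sq_le δmin_le_δ δmin_le_δ₂ δmin_le_δr δmin_le_δA kitK kitN kitL
  cellsOf tOf Kof gapFn K₀_le_cellsOf_K kitK_mul_le_kitN kitL_pos kit_counts_at_le cellsOf_r cellsOf_s hundred_mul_le_tOf
  hundred_mul_succ_le_tOf succ_le_tOf le_Erad_gapFn)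

namespace Conc

/-! ### The planar / level constants (no law involved) -/

section Consts

variable {κ : Consts} {V : Type} [Countable V] {G : SimpleGraph V} [G.LocallyFinite] {Φ : PlanarSkeletonConc G}
  {p : unitInterval} {hC : Φ.toPlanarSkeleton.CylSubcritical p} {δA : ℝ} {M : ℕ}

/-- `R' = L + 8 M + 13`. [folklore] -/
theorem R'c_eq : R'c κ Φ p hC δA M = Lc κ Φ p hC δA M + 8 * M + 13 := rfl

/-- `t = K · (100 (R' + 1))`. [folklore] -/
theorem tc_eq : tc κ Φ p hC δA M = Kof κ.K₀ * (100 * (R'c κ Φ p hC δA M + 1)) := rfl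

/-- `R' + 1 ≤ t`. [folklore] -/
theorem R'c_succ_le_tc : R'c κ Φ p hC δA M + 1 ≤ tc κ Φ p hC δA M := succ_le_tOf _ _

/-- `M < 6 t`. [folklore] -/
theorem lt_six_tc : M < 6 * tc κ Φ p hC δA M := by
  have h := R'c_succ_le_tc (κ := κ) (Φ := Φ) (p := p) (hC := hC) (δA := δA) (M := M)
  rw [R'c_eq] at h; omega

/-- The kit scale lies in the scale set. [folklore] -/
theorem mem_Sc : M ∈ Sc κ Φ p hC δA M := Finset.mem_Icc.2 ⟨le_rfl, lt_six_tc.le⟩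

/-- The route scales `[M+1, 6t]` lie in the scale set. [folklore] -/
theorem Icc_subset_Sc : Finset.Icc (M + 1) (6 * tc κ Φ p hC δA M) ⊆ Sc κ Φ p hC δA M :=
  Finset.Icc_subset_Icc_left (Nat.le_succ M)

/-- A scale `ℓ ∈ [M, 6t]` lies in the scale set. [folklore] -/
theorem mem_Sc_of {ℓ : ℕ} (h₁ : M ≤ ℓ) (h₂ : ℓ ≤ 6 * tc κ Φ p hC δA M) : ℓ ∈ Sc κ Φ p hC δA M := Finset.mem_Icc.2 ⟨h₁, h₂⟩

/-- `ψ M ≤ ψ (6 t)` (the kit scale is below the top route scale). [folklore] -/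
theorem ψ_le_ψ_top : ψ Φ p hC M ≤ ψ Φ p hC (6 * tc κ Φ p hC δA M) := Skel.fatRadius_mono Φ hC lt_six_tc.le

/-- `ψ` is monotone. [folklore] -/
theorem ψ_mono {m n : ℕ} (h : m ≤ n) : ψ Φ p hC m ≤ ψ Φ p hC n := Skel.fatRadius_mono Φ hC h

/-- `r = 4 t`. [folklore] -/
theorem hr : (Cc κ Φ p hC δA M).r = 4 * tc κ Φ p hC δA M := cellsOf_r _ _

/-- `100 R' ≤ t`. [folklore] -/
theorem hR100 : 100 * R'c κ Φ p hC δA M ≤ tc κ Φ p hC δA M := hundred_mul_le_tOf _ _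

/-- `M + L + 1 ≤ R'` (`Rlev := M + L` fits). [folklore] -/
theorem hRl : M + Lc κ Φ p hC δA M + 1 ≤ R'c κ Φ p hC δA M := by rw [R'c_eq]; omega

/-- `R' + (M + 1) ≤ t` (the route scales `ℓ₀ := M + 1` fit in one advance). [folklore] -/
theorem hℓ₀ : R'c κ Φ p hC δA M + (M + 1) ≤ tc κ Φ p hC δA M := by
  have h := hundred_mul_succ_le_tOf κ.K₀ (R'c κ Φ p hC δA M)
  unfold tc; rw [R'c_eq] at h ⊢; omega

/-- `K₀ ≤ K`. [folklore] -/
theorem hK₀ : κ.K₀ ≤ (Cc κ Φ p hC δA M).K := K₀_le_cellsOf_K _ _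

/-- `K = max 20 K₀`. [folklore] -/
theorem Cc_K : (Cc κ Φ p hC δA M).K = Kof κ.K₀ := rfl

/-- `s = 400 (R' + 1)`. [folklore] -/
theorem Cc_s : (Cc κ Φ p hC δA M).s = 400 * (R'c κ Φ p hC δA M + 1) := rfl

/-- The stub-level width absorbs the level window, the slab margins and the kit cubes: `L + 16 M + 30 ≤ 10 s` (generous). [folklore] -/
theorem hwide : Lc κ Φ p hC δA M + 16 * M + 30 ≤ 10 * (Cc κ Φ p hC δA M).s := by
  rw [Cc_s, R'c_eq]; omega

/-! #### The kit constants dominate the seed-slab-v3 minima (p3-g4 20:47:14Z / p1-g7 20:33:00Z) -/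

/-- `cylRadMax (M+1) (7M+11) ≤ R′_seed` (p3's `kitOK_slabCube.hR'₁`, by monotonicity in the radius). [folklore] -/
theorem cylRadMax_T₀_le_Rseedc : Φ.cylRadMax (M + 1) (7 * M + 11) ≤ Rseedc Φ p hC M :=
  le_trans (Φ.cylRadMax_mono _ (by omega)) (le_max_left _ _)

/-- `cylRadMax (M+1) (7M+13) ≤ R′_seed` (p1's form). [folklore] -/
theorem cylRadMax_T₀'_le_Rseedc : Φ.cylRadMax (M + 1) (7 * M + 13) ≤ Rseedc Φ p hC M := le_max_left _ _

/-- `cylRadMax (M+1) (2M+3+ψ M) ≤ R′_seed` (the `M`-prism's comparison radius). [folklore] -/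
theorem cylRadMax_ψ_le_Rseedc : Φ.cylRadMax (M + 1) (2 * M + 3 + ψ Φ p hC M) ≤ Rseedc Φ p hC M := le_max_right _ _

/-- `T₀ = 3M + 4`, `cS = (Δ+1)^{R′_seed} + (T₀ + 2)`, `sB = 1 + Δ cS + cS cU`, `B = (Δ+1)^{2 rs}` (by `rfl`). [folklore] -/
theorem sBc_eq : sBc Φ p hC M = 1 + Φ.Δ * cSc Φ p hC M + cSc Φ p hC M * cUc Φ p hC M := rfl

/-- `cS = (Δ+1)^{R′_seed} + (3M + 6)`. [folklore] -/
theorem cSc_eq : cSc Φ p hC M = (Φ.Δ + 1) ^ Rseedc Φ p hC M + (3 * M + 4 + 2) := rfl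

/-- `cU = (Δ+1)^{ψ M}`. [folklore] -/
theorem cUc_eq : cUc Φ p hC M = (Φ.Δ + 1) ^ ψ Φ p hC M := rfl

/-- `B = (Δ+1)^{2 rs}`. [folklore] -/
theorem Bc_eq : Bc Φ p hC M = (Φ.Δ + 1) ^ (2 * rsc Φ p hC M) := rfl

/-- The apartness radius dominates both posted minima: `7M + 12 + R′_seed ≤ rs` and `6M + 9 + ψ M ≤ rs` (hence `4M + 7 + R′_seed ≤ rs`). [folklore] -/
theorem rsc_ge : 7 * M + 12 + Rseedc Φ p hC M ≤ rsc Φ p hC M ∧ 6 * M + 9 + ψ Φ p hC M ≤ rsc Φ p hC M := ⟨le_max_left _ _, le_max_right _ _⟩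

/-- **p1-g7's nine seed-kit inequalities (21:44:22Z) at `ℓ_s = M + 1`, `T₀ = 3M + 4`, `R′ := Rseedc`, `r₀ := r₀c`, `rs := rsc`**:
`hR'₁`, `hR'₂`, `hr₀₁ : ℓs+1+T₀+R′ ≤ r₀`, `hr₀₂ : 2ℓs+2+T₀+M+ψM ≤ r₀`, `hrs₁ : ℓs+2+T₀+R′ ≤ rs`, `hrs₂ : 2ℓs+3+T₀+M+ψM ≤ rs` (numerals expanded;
`hMℓ : M + 1 ≤ ℓs` is `le_rfl`). [folklore] -/
theorem seedKit_ineqs :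
    Φ.cylRadMax (M + 1) ((M + 1) + 2 + 2 * (3 * M + 4)) ≤ Rseedc Φ p hC M ∧ Φ.cylRadMax (M + 1) ((M + 1) + 2 + M + ψ Φ p hC M) ≤ Rseedc Φ p hC M ∧
    (M + 1) + 1 + (3 * M + 4) + Rseedc Φ p hC M ≤ r₀c Φ p hC M ∧ 2 * (M + 1) + 2 + (3 * M + 4) + M + ψ Φ p hC M ≤ r₀c Φ p hC M ∧
    (M + 1) + 2 + (3 * M + 4) + Rseedc Φ p hC M ≤ rsc Φ p hC M ∧ 2 * (M + 1) + 3 + (3 * M + 4) + M + ψ Φ p hC M ≤ rsc Φ p hC M := by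
  refine ⟨le_trans (Φ.cylRadMax_mono _ (by omega)) (le_max_left _ _), le_trans (Φ.cylRadMax_mono _ (by omega)) (le_max_right _ _), ?_, ?_, ?_, ?_⟩
  · exact le_trans (by omega) (le_max_left _ _ : 4 * M + 6 + Rseedc Φ p hC M ≤ r₀c Φ p hC M)
  · exact le_trans (by omega) (le_max_right _ _ : 6 * M + 8 + ψ Φ p hC M ≤ r₀c Φ p hC M)
  · exact le_trans (by omega) (le_max_left _ _ : 7 * M + 12 + Rseedc Φ p hC M ≤ rsc Φ p hC M)
  · exact le_trans (by omega) (le_max_right _ _ : 6 * M + 9 + ψ Φ p hC M ≤ rsc Φ p hC M)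

/-- `r₀ ≤ rs ≤ reachK` (the near threshold is inside the kit reach, hence `r₀ ≤ L' ≤ E₀ ≤` every window radius). [folklore] -/
theorem r₀c_le : r₀c Φ p hC M ≤ rsc Φ p hC M ∧ r₀c Φ p hC M ≤ reachK Φ p hC M := by
  have h1 : r₀c Φ p hC M ≤ rsc Φ p hC M := by
    unfold r₀c rsc
    exact max_le (le_trans (by omega) (le_max_left _ _)) (le_trans (by omega) (le_max_right _ _))
  exact ⟨h1, le_trans h1 (by unfold reachK; omega)⟩

/-- `rs ≤ reachK` and `R′_seed ≤ reachK` and `6M + 9 + ψ M ≤ reachK` (every kit piece of a contact lies within `reachK` of it). [folklore] -/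
theorem reachK_ge : rsc Φ p hC M ≤ reachK Φ p hC M ∧ Rseedc Φ p hC M ≤ reachK Φ p hC M ∧ 6 * M + 9 + ψ Φ p hC M ≤ reachK Φ p hC M := by
  refine ⟨?_, ?_, ?_⟩ <;> unfold reachK <;> omega

/-- **`hN`**: `k · B ≤ N` (needs `0 < δA`, `0 < p < 1`). [folklore] -/
theorem hN_at (h0 : 0 < δA) (hp0 : 0 < (p : ℝ)) (hp1 : (p : ℝ) < 1) :
    kc κ Φ p hC δA M * Bc Φ p hC M ≤ Nc κ Φ p hC δA M :=
  kitK_mul_le_kitN _ _ _ (δmin_pos (κ.prod Φ.Δ) nR h0) p hp0 hp1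

/-- `0 < L`. [folklore] -/
theorem Lc_pos (h0 : 0 < δA) (hp0 : 0 < (p : ℝ)) (hp1 : (p : ℝ) < 1) : 0 < Lc κ Φ p hC δA M :=
  kitL_pos _ _ _ (δmin_pos (κ.prod Φ.Δ) nR h0) p hp0 hp1

end Consts

/-! ### The scheme, the inputs at the running parameter, the counts and the excess radius -/

section AtQ

variable {κ : Consts} {V : Type} [DecidableEq V] [Countable V] {G : SimpleGraph V} [G.LocallyFinite] {Φ : PlanarSkeletonConc G} {t : V}
  {p : unitInterval} {hC : Φ.toPlanarSkeleton.CylSubcritical p} {δA : ℝ} {hδA : 0 < δA} {msel : V → ℕ} {M : ℕ}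
  {q : unitInterval}

/-- The scheme of the concrete choices is `concSchemeSG Φ C t Λ q κ.δ` with the concrete `C`, `Λ` (by `rfl`). [folklore] -/
theorem scheme_eq (hδA : 0 < δA) (msel : V → ℕ) (M : ℕ) (q : unitInterval) :
    (choiceAt κ Φ t p hC hδA).scheme msel M q =
      concSchemeSG Φ (Cc κ Φ p hC δA M) t (Λc κ Φ p hC δA M q) q κ.δ := rfl

/-- The face data of the concrete choices (by `rfl`). [folklore] -/
theorem faces_eq (hδA : 0 < δA) (msel : V → ℕ) (M : ℕ) (q : unitInterval) :
    (choiceAt κ Φ t p hC hδA).faces msel M q = Skel.faceDataSG Φ (Cc κ Φ p hC δA M) t (Λc κ Φ p hC δA M q) := rfl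

omit [DecidableEq V] in
/-- The schedule of the concrete choices (by `rfl`). [folklore] -/
theorem Λc_eq (M : ℕ) (q : unitInterval) : Λc κ Φ p hC δA M q =
    Skel.concRadiiS (Cc κ Φ p hC δA M) (gapc κ Φ p hC δA M q) (fun _ => 0) (E₀c κ Φ p hC δA M q)
      (L'c κ Φ p hC δA M q) := rfl

variable (hat : (choiceAt κ Φ t p hC hδA).AtQ msel M q)
include hat

/-- `msel τ ≤ M` on the base vertices. [folklore] -/
theorem hmsel_at : ∀ τ ∈ Φ.types, msel τ ≤ M := fun τ hτ => (hat.1 τ hτ).2.le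

/-- `msel τ < M` on the base vertices. [folklore] -/
theorem hmsel_lt_at : ∀ τ ∈ Φ.types, msel τ < M := fun τ hτ => (hat.1 τ hτ).2

/-- `Φ.CylSubcritical q`. [folklore] -/
theorem cyl_at : Φ.toPlanarSkeleton.CylSubcritical q := hat.2.2.2.2

/-- The inputs at `q` over `Φ.types × Icc M (6 t)` at accuracy `δmin²`. [folklore] -/
theorem inputs_at : ∀ i ∈ Skel.inputIndex Φ (Sc κ Φ p hC δA M),
    1 - δmin (κ.prod Φ.Δ) nR δA ^ 2 < (bondPercolation G q).real (Skel.inputEvent Φ hC msel i) := hat.2.2.2.1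

/-- The inputs at `q` at any accuracy `a ≥ δmin` (margin `a²`; feeds `Skel.exists_inputs_at_center_all` at any centre). [folklore] -/
theorem inputs_at_le {a : ℝ} (ha : δmin (κ.prod Φ.Δ) nR δA ≤ a) : ∀ i ∈ Skel.inputIndex Φ (Sc κ Φ p hC δA M),
    1 - a ^ 2 < (bondPercolation G q).real (Skel.inputEvent Φ hC msel i) := fun i hi => by
  have hsq := δmin_sq_le (κ := κ.prod Φ.Δ) (nR := nR) hδA ha
  have h := inputs_at hat i hi
  linarith

/-- **`hstd` at a scale `ℓ ∈ [M, 6t]`** at any accuracy `a ≥ δmin`, at every base vertex: the uniqueness zone and the eight links of the fat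
prism of scale `ℓ`. [folklore] -/
theorem hstd_at_scale {a : ℝ} (ha : δmin (κ.prod Φ.Δ) nR δA ≤ a) {ℓ : ℕ} (h₁ : M ≤ ℓ) (h₂ : ℓ ≤ 6 * tc κ Φ p hC δA M) :
    ∀ τ ∈ Φ.types,
      1 - a ^ 2 < (bondPercolation G q).real (UniqZone.zone G (Skel.fatSeq Φ hC τ) (msel τ) ℓ) ∧
      ∀ g : HOct 2, 1 - a ^ 2 < (bondPercolation G q).real
        (linkIn (↑(Skel.fatSeq Φ hC τ ℓ)) (Skel.fatSeq Φ hC τ (msel τ)) (Skel.macroPiece Φ τ ℓ (Skel.fatRadius Φ hC ℓ) g)) := by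
  intro τ hτ
  have hsq := δmin_sq_le (κ := κ.prod Φ.Δ) (nR := nR) hδA ha
  obtain ⟨h1, h2⟩ := Skel.hstd_of_inputs Φ hC msel (inputs_at hat) (mem_Sc_of h₁ h₂) τ hτ
  exact ⟨by linarith, fun g => by linarith [h2 g]⟩

/-- **`hstd` at the kit scale `M`** at any accuracy `a ≥ δmin` (so `a := δ`, `δ₂`, `δr 44`, `δA`, `δUP n (δ₂²)`, `δC`). [folklore] -/
theorem hstd_at {a : ℝ} (ha : δmin (κ.prod Φ.Δ) nR δA ≤ a) : ∀ τ ∈ Φ.types,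
    1 - a ^ 2 < (bondPercolation G q).real (UniqZone.zone G (Skel.fatSeq Φ hC τ) (msel τ) M) ∧
      ∀ g : HOct 2, 1 - a ^ 2 < (bondPercolation G q).real
        (linkIn (↑(Skel.fatSeq Φ hC τ M)) (Skel.fatSeq Φ hC τ (msel τ)) (Skel.macroPiece Φ τ M (Skel.fatRadius Φ hC M) g)) :=
  hstd_at_scale hat ha le_rfl lt_six_tc.le

/-- **`hlink` at the route scales `ℓ ∈ [M+1, 6t]`** at any accuracy `a ≥ δmin`, at every base vertex. [folklore] -/
theorem hlink_at {a : ℝ} (ha : δmin (κ.prod Φ.Δ) nR δA ≤ a) : ∀ ℓ, M + 1 ≤ ℓ → ℓ ≤ 6 * tc κ Φ p hC δA M → ∀ τ ∈ Φ.types, ∀ g : HOct 2,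
    1 - a ^ 2 < (bondPercolation G q).real
      (linkIn (↑(Skel.fatSeq Φ hC τ ℓ)) (Skel.fatSeq Φ hC τ (msel τ)) (Skel.macroPiece Φ τ ℓ (Skel.fatRadius Φ hC ℓ) g)) :=
  fun _ h₁ h₂ τ hτ g => ((hstd_at_scale hat ha ((Nat.le_succ M).trans h₁) h₂) τ hτ).2 g

/-- **`hk`** at any accuracy `a ≥ δmin`: `(1 - q^{s_B})^k ≤ a`. [folklore] -/
theorem hk_at (hp0 : 0 < (p : ℝ)) (hp1 : (p : ℝ) < 1) {a : ℝ} (ha : δmin (κ.prod Φ.Δ) nR δA ≤ a) :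
    (1 - (q : ℝ) ^ sBc Φ p hC M) ^ kc κ Φ p hC δA M ≤ a :=
  (kit_counts_at_le _ _ _ (δmin_pos (κ.prod Φ.Δ) nR hδA) ha p hp0 hp1 hat.2.1 hat.2.2.1).1

/-- **`hcount`** at any accuracy `a ≥ δmin` and any level count `L' ≥ L`: `1/(1-q)^{Δ N} ≤ a · L'`. [folklore] -/
theorem hcount_at (hp0 : 0 < (p : ℝ)) (hp1 : (p : ℝ) < 1) {a : ℝ} (ha : δmin (κ.prod Φ.Δ) nR δA ≤ a) {L' : ℕ}
    (hL' : Lc κ Φ p hC δA M ≤ L') : 1 / (1 - (q : ℝ)) ^ (Φ.Δ * Nc κ Φ p hC δA M) ≤ a * (L' : ℝ) :=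
  (kit_counts_at_le _ _ _ (δmin_pos (κ.prod Φ.Δ) nR hδA) ha p hp0 hp1 hat.2.1 hat.2.2.1).2 L' hL'

/-- **`hcount`** for a window `Icc (j₀ + 1) (j₀ + L)` (card `L`). [folklore] -/
theorem hcount_Icc_at (hp0 : 0 < (p : ℝ)) (hp1 : (p : ℝ) < 1) {a : ℝ} (ha : δmin (κ.prod Φ.Δ) nR δA ≤ a) (j₀ : ℕ) :
    1 / (1 - (q : ℝ)) ^ (Φ.Δ * Nc κ Φ p hC δA M) ≤ a * ((Finset.Icc (j₀ + 1) (j₀ + Lc κ Φ p hC δA M)).card : ℝ) := by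
  rw [BoxProdZ2.card_Icc_levels]; exact hcount_at hat hp0 hp1 ha le_rfl

/-- **The excess radius at `q` at any centre `c` and any entrance depth `ρ`** ((F)'s `hR₁` with `R₁ ρ := Rex q (ρ+1)` — take `ρ + 1`; (C)'s
`hRex`; (R)'s rim input), any `η ≥ δmin/2`. [folklore] -/
theorem hRex_at {η : ℝ} (hη : ηc κ Φ δA ≤ η) (c : V) : ∀ ρ R', Rexc κ Φ p hC δA M q ρ ≤ R' →
    ∀ (Rw : ℕ) (D A : Finset V), (∀ d ∈ D, d ∈ graphBall G c Rw) →
      (∀ d ∈ D, ∀ d' ∈ D, Φ.φ d - Φ.φ d' ∈ box 2 (60 * (Cc κ Φ p hC δA M).r)) → A ⊆ D → (∀ a ∈ A, a ∈ graphBall G c ρ) →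
        (bondPercolation G q).real (Skel.excess G c R' D A) ≤ η :=
  fun ρ R' hR' Rw D A hD hm hAD hA => (excessRadiusAtK_spec_at Φ _ (half_pos (δmin_pos (κ.prod Φ.Δ) nR hδA)) (cyl_at hat) ρ c R' hR'
    Rw D A hD hm hAD hA).trans hη

/-- **The excess radius at `q`, any planar diameter `m ≤ 60 r`** (so (F)/(C)'s `50 r` clauses verbatim). [folklore] -/
theorem hRex_at_le {η : ℝ} (hη : ηc κ Φ δA ≤ η) (c : V) {m : ℕ} (hm : m ≤ 60 * (Cc κ Φ p hC δA M).r) : ∀ ρ R', Rexc κ Φ p hC δA M q ρ ≤ R' →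
    ∀ (Rw : ℕ) (D A : Finset V), (∀ d ∈ D, d ∈ graphBall G c Rw) → (∀ d ∈ D, ∀ d' ∈ D, Φ.φ d - Φ.φ d' ∈ box 2 m) → A ⊆ D →
      (∀ a ∈ A, a ∈ graphBall G c ρ) → (bondPercolation G q).real (Skel.excess G c R' D A) ≤ η :=
  fun ρ R' hR' Rw D A hD hm' hAD hA => hRex_at hat hη c ρ R' hR' Rw D A hD (fun d hd d' hd' => box_mono 2 hm (hm' d hd d' hd')) hAD hA

end AtQ

/-! ### The schedule and the radii by name -/

section Sched

variable {κ : Consts} {V : Type} [Countable V] {G : SimpleGraph V} [G.LocallyFinite] {Φ : PlanarSkeletonConc G}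
  {p : unitInterval} {hC : Φ.toPlanarSkeleton.CylSubcritical p} {δA : ℝ} {M : ℕ} {q : unitInterval}

/-- `(F)`: `2 L' + R₁ ρ + 100 r ≤ gap ρ` with `R₁ ρ := Rex q (ρ + 1)`. [folklore] -/
theorem hgap_face (ρ : ℕ) : 2 * L'c κ Φ p hC δA M q + Rexc κ Φ p hC δA M q (ρ + 1) + 100 * (Cc κ Φ p hC δA M).r ≤
    gapc κ Φ p hC δA M q ρ :=
  two_mul_add_add_le_gapFn_drift _ _ _ ρ

/-- `(C)`: `L' ≤ gap ρ`. [folklore] -/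
theorem hgapL (ρ : ℕ) : L'c κ Φ p hC δA M q ≤ gapc κ Φ p hC δA M q ρ := BoxProdZ2.le_gapFn _ _ ρ

/-- `100 r ≤ gap ρ` (the planar drift fits in every gap). [folklore] -/
theorem dG_le_gap (ρ : ℕ) : 100 * (Cc κ Φ p hC δA M).r ≤ gapc κ Φ p hC δA M q ρ := le_gapFn_drift _ _ _ ρ

/-- `(C)`: `Rex q (E g + 1) + 100 r + L' ≤ E (g + 1)`. [folklore] -/
theorem hsch (g : ℕ) :
    Rexc κ Φ p hC δA M q (Erad (gapc κ Φ p hC δA M q) (fun _ => 0) (E₀c κ Φ p hC δA M q) g + 1) +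
        100 * (Cc κ Φ p hC δA M).r + L'c κ Φ p hC δA M q ≤
      Erad (gapc κ Φ p hC δA M q) (fun _ => 0) (E₀c κ Φ p hC δA M q) (g + 1) :=
  sch_gapFn_drift _ _ _ _ g

/-- `(R)`: the root tube radius `F 1 - L' = E₀ + L' + 1 + Rex q (E₀ + 1) + 100 r`. [folklore] -/
theorem hRt : Frad (gapc κ Φ p hC δA M q) (fun _ => 0) (E₀c κ Φ p hC δA M q) 1 - L'c κ Φ p hC δA M q =
    E₀c κ Φ p hC δA M q + L'c κ Φ p hC δA M q + 1 + Rexc κ Φ p hC δA M q (E₀c κ Φ p hC δA M q + 1) +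
      100 * (Cc κ Φ p hC δA M).r :=
  Frad_one_gapFn_drift _ _ _ _

/-- `LA + ψ M ≤ L'` ((F)'s `hL`; indeed with slack `ψ (6t) + 12 t + 2 M`). [folklore] -/
theorem hL_face : LAc κ Φ p hC δA M q + ψ Φ p hC M ≤ L'c κ Φ p hC δA M q := by unfold L'c; omega

/-- `ψ (6t) + ψ M + 12 t + 2 M ≤ L'` (the prism-scale allowance of SHEAR-SCOPE §p3 3.0 item 2). [folklore] -/
theorem hL_reach : ψ Φ p hC (6 * tc κ Φ p hC δA M) + ψ Φ p hC M + 12 * tc κ Φ p hC δA M + 2 * M ≤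
    L'c κ Φ p hC δA M q := by unfold L'c; omega

/-- `reachK ≤ L'` (so `r₀ ≤ rs ≤ reachK ≤ L' ≤ E₀ ≤` every realised window radius). [folklore] -/
theorem reachK_le_L' : reachK Φ p hC M ≤ L'c κ Φ p hC δA M q := by unfold L'c; omega

/-- `L' ≤ E₀`. [folklore] -/
theorem L'_le_E₀ : L'c κ Φ p hC δA M q ≤ E₀c κ Φ p hC δA M q := by unfold E₀c; omega

/-- **`45 r + ψ M ≤ E₀`** (the root corridor sets reach planar level `22 r`; column room). [folklore] -/
theorem planar_le_E₀ : 45 * (Cc κ Φ p hC δA M).r + ψ Φ p hC M ≤ E₀c κ Φ p hC δA M q := by unfold E₀c; omega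

/-- **`44 r + 4 ≤ E₀`** (the (C)/(R) column room `20 r ‖y‖₁ + 44 r + 1 ≤ rQ`, `r ≥ 4`). [folklore] -/
theorem fortyfour_le_E₀ : 44 * (Cc κ Φ p hC δA M).r + 4 ≤ E₀c κ Φ p hC δA M q := by
  have hr : 20 * (Cc κ Φ p hC δA M).s ≤ (Cc κ Φ p hC δA M).r := (Cc κ Φ p hC δA M).twenty_mul_s_le_r
  rw [Cc_s] at hr
  unfold E₀c; omega

/-- `24 r ≤ L_A` (the inner run's planar travel is inside the inner graph radius). [folklore] -/
theorem planar_le_LA : 24 * (Cc κ Φ p hC δA M).r ≤ LAc κ Φ p hC δA M q := by unfold LAc; omega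

/-- `L_A + 2 ψ M + reachK M + 1 ≤ L'` (deep / rim dichotomy with the kit reach; `12 t ≥ 1`). [folklore] -/
theorem LA_reach_le_L' : LAc κ Φ p hC δA M q + 2 * ψ Φ p hC M + reachK Φ p hC M + 1 ≤ L'c κ Φ p hC δA M q := by
  have ht : 1 ≤ tc κ Φ p hC δA M := le_trans (by omega) (R'c_succ_le_tc (κ := κ) (Φ := Φ) (p := p) (hC := hC) (δA := δA) (M := M))
  have hψ := ψ_le_ψ_top (κ := κ) (Φ := Φ) (p := p) (hC := hC) (δA := δA) (M := M)
  unfold L'c; omega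

/-- `L' ≤ E g`. [folklore] -/
theorem L'_le_Erad (g : ℕ) : L'c κ Φ p hC δA M q ≤ Erad (gapc κ Φ p hC δA M q) (fun _ => 0) (E₀c κ Φ p hC δA M q) g :=
  L'_le_E₀.trans (le_Erad_gapFn _ _ _ g)

/-- `ψ (6 t) ≤ E₀` ((R)'s first hop at scale `6 t` inside the wired root cube). [folklore] -/
theorem ψ_top_le_E₀ : ψ Φ p hC (6 * tc κ Φ p hC δA M) ≤ E₀c κ Φ p hC δA M q := by unfold E₀c L'c; omega

/-- `ψ M ≤ E₀`. [folklore] -/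
theorem ψ_le_E₀ : ψ Φ p hC M ≤ E₀c κ Φ p hC δA M q := by unfold E₀c; omega

/-- `ψ M ≤ E g`. [folklore] -/
theorem ψ_le_Erad (g : ℕ) : ψ Φ p hC M ≤ Erad (gapc κ Φ p hC δA M q) (fun _ => 0) (E₀c κ Φ p hC δA M q) g :=
  ψ_le_E₀.trans (le_Erad_gapFn _ _ _ g)

/-- The inner rim allowance: `24 r + ψ (6t) + ψ M + Rex q (2 ψ M) + dL ≤ L_A - (ψ (6 t) + ψ M)`. [folklore] -/
theorem inner_rim_le : 24 * (Cc κ Φ p hC δA M).r + ψ Φ p hC (6 * tc κ Φ p hC δA M) + ψ Φ p hC M +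
    Rexc κ Φ p hC δA M q (2 * ψ Φ p hC M) + dL κ Φ p hC δA M ≤
      LAc κ Φ p hC δA M q - (ψ Φ p hC (6 * tc κ Φ p hC δA M) + ψ Φ p hC M) := by
  unfold LAc; omega

/-- `dL = 24 t + 8 M + 12`. [folklore] -/
theorem dL_eq : dL κ Φ p hC δA M = 24 * tc κ Φ p hC δA M + 8 * M + 12 := rfl

/-- **The cen bound of the inflated cube radius**: `20 r · j + 1 ≤ E k` whenever `j ≤ k` (so `Skel.concRadiiS_rQ_eq_of_norm_le` applies at every
run pair with `‖x‖₁ ≤ nQ a x`: gap `≥ 100 r ≥ 20 r`, `E₀ ≥ 1`). [folklore] -/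
theorem cen_le_Erad_at {j k : ℕ} (hjk : j ≤ k) :
    20 * (Cc κ Φ p hC δA M).r * j + 1 ≤ Erad (gapc κ Φ p hC δA M q) (fun _ => 0) (E₀c κ Φ p hC δA M q) k :=
  cen_bound_le_Erad_drift _ _ _ _ (by omega) (le_trans (by norm_num) (two_le_E₀c κ Φ p hC δA M q)) hjk

/-- Every gap is `≥ 20 r` (the hypothesis of `Skel.off_le_Erad` / `concRadiiS_rQ_eq_of_norm_le`). [folklore] -/
theorem twenty_r_le_gap : ∀ n, 20 * (Cc κ Φ p hC δA M).r ≤ gapc κ Φ p hC δA M q n :=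
  fun n => le_trans (by omega) (dG_le_gap (κ := κ) (q := q) n)

/-- `1 ≤ E₀`. [folklore] -/
theorem one_le_E₀ : 1 ≤ E₀c κ Φ p hC δA M q := le_trans (by norm_num) (two_le_E₀c κ Φ p hC δA M q)

end Sched

end Conc

end SkelConc

end Transplant

end Summit.CriticalPhenomena.PercolationContinuityZ3.Theorems

end
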